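import Literature.AlgebraicGeometry.Resolution.AlterationsFormalNodes
import Literature.AlgebraicGeometry.Resolution.PowerSeriesRegularLocal
import Literature.AlgebraicGeometry.Resolution.RegularLocalRingsUFD
import Mathlib.RingTheory.MvPowerSeries.NoZeroDivisors
import Mathlib.RingTheory.MvPowerSeries.Trunc
import Mathlib.Algebra.MvPolynomial.Equiv
import Mathlib.Algebra.MvPolynomial.Division
import Mathlib.Algebra.Polynomial.RingDivision
import HarnessLib

/-!
# The formal node ring `k⟦u, v, T₁, …, T_m⟧/(uv - ∏ Tᵢ^{νᵢ})` is an integral domain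

Topic: `Literature/AlgebraicGeometry/Resolution`. Commutative algebra underneath de Jong 1996,
3.3–3.4: the complete local ring `B ≅ A⟦u, v⟧/(uv - t₁^{n₁} ⋯ t_r^{n_r})` of the total space of a
semi-stable curve at a closed point of `Sing(f)` (3.3), in its split form
`DeJong1996.FormalNodeRing k m ν = k⟦u, v, T₁, …, T_m⟧/(uv - ∏ Tᵢ^{νᵢ})`
(`AlterationsFormalNodes.lean`), and — after the blow-up of 3.4 — the completed local rings
`k⟦u', v', T⟧/(u'v' - T₁^{n₁-2} T₂^{n₂} ⋯)` of the blown-up curve at the closed points of the new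
component ("Chart "`t₁ ≠ 0`". — Here we get `A[u, v, u', v']/(u - t₁u', v - t₁v', u'v' - t₁^{n₁-2}
t₂^{n₂} ⋯ t_r^{n_r})`", p. 64). To recognise an abstract complete local ring as such a ring one
maps the model onto it and needs the model to be an INTEGRAL DOMAIN; the tree had this only for
exponents `νᵢ ≤ 1` (`DeJong1996.NodalFamilyRing.isDomain`, `NodalFamilyRingDomain.lean`, by killing
variables). This file PROVES it for arbitrary exponents `ν ≠ 0`:

* `MvPowerSeries.irreducible_coe_of_isWeightedHomogeneous` — **a weighted-homogeneous polynomial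
  (all weights positive) which is irreducible in `k[X]` is irreducible in `k⟦X⟧`**: if `F = GH`
  in `k⟦X⟧` then the initial forms multiply, `F = in(G) · in(H)` (Mathlib
  `MvPowerSeries.weightedHomogeneousComponent_mul_of_le_weightedOrder`, `weightedOrder_mul`), and
  the initial forms are polynomials (finitely many monomials of a given weight);
* `MvPolynomial.irreducible_X_mul_X_sub_rename` — `X_u X_v - M` is irreducible in `k[X]` for a
  polynomial `M` not involving `X_v` and not divisible by `X_u`: as a polynomial in `X_v` over
  `k[X_c : c ≠ v]` (Mathlib `MvPolynomial.optionEquivLeft`) it is `X_u · X_v - M`, of degree one,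
  and a constant factor would divide both `X_u` (a prime, `MvPolynomial.X_prime`) and `M`;
* `DeJong1996.prime_formalNodeRelation`, `DeJong1996.FormalNodeRing.isDomain` — hence, `k⟦X⟧`
  being factorial (a regular local ring), `uv - ∏ Tᵢ^{νᵢ}` is a prime element of
  `k⟦u, v, T₁, …, T_m⟧` and the formal node ring is an integral domain, for every `ν ≠ 0`
  (weights `w(u) = w(v) = Σ νᵢ`, `w(Tᵢ) = 2`).

## Sources

* A. J. de Jong, *Smoothness, semi-stability and alterations*, Publ. Math. IHÉS 83 (1996) 51–93:
  3.3–3.4, pp. 63–64. [DeJong1996]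
* H. Matsumura, *Commutative Ring Theory* (1986), Thm. 20.3 (regular local rings are factorial),
  via `RegularLocalRingsUFD.lean`. [Matsumura1987]
-/

noncomputable section

namespace Literature.AlgebraicGeometry.Resolution

universe u

open IsLocalRing

/-! ## Initial forms: irreducibility passes from `k[X]` to `k⟦X⟧` for weighted-homogeneous polynomials -/

section InitialForms

variable {σ : Type*} {k : Type*} [Field k]

/-- A variable is weighted-homogeneous of its weight. [folklore] -/
theorem MvPowerSeries.isWeightedHomogeneous_X' [DecidableEq σ] (w : σ → ℕ) (s : σ) :
    (MvPowerSeries.X s : MvPowerSeries σ k).IsWeightedHomogeneous w (w s) := by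
  intro d hd
  rw [MvPowerSeries.coeff_X] at hd
  split_ifs at hd with h
  · rw [h, Finsupp.weight_single, smul_eq_mul, one_mul]
  · exact absurd rfl hd

/-- `1` is weighted-homogeneous of weight `0`. [folklore] -/
theorem MvPowerSeries.isWeightedHomogeneous_one' (w : σ → ℕ) :
    (1 : MvPowerSeries σ k).IsWeightedHomogeneous w 0 := by
  classical
  intro d hd
  rw [MvPowerSeries.coeff_one] at hd
  split_ifs at hd with h
  · rw [h, map_zero]
  · exact absurd rfl hd

/-- Negation preserves weighted homogeneity. [folklore] -/
theorem MvPowerSeries.IsWeightedHomogeneous.neg' {w : σ → ℕ} {f : MvPowerSeries σ k} {p : ℕ}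
    (hf : f.IsWeightedHomogeneous w p) : (-f).IsWeightedHomogeneous w p := by
  intro d hd
  rw [map_neg, neg_ne_zero] at hd
  exact hf hd

/-- Differences of weighted-homogeneous series of the same weight are weighted-homogeneous.
[folklore] -/
theorem MvPowerSeries.IsWeightedHomogeneous.sub' {w : σ → ℕ} {f g : MvPowerSeries σ k} {p : ℕ}
    (hf : f.IsWeightedHomogeneous w p) (hg : g.IsWeightedHomogeneous w p) :
    (f - g).IsWeightedHomogeneous w p := by
  intro d hd
  by_contra hne
  apply hd
  rw [map_sub, hf.coeff_eq_zero hne, hg.coeff_eq_zero hne, sub_zero]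

/-- Powers of a weighted-homogeneous series are weighted-homogeneous. [folklore] -/
theorem MvPowerSeries.IsWeightedHomogeneous.pow' {w : σ → ℕ} {f : MvPowerSeries σ k} {p : ℕ}
    (hf : f.IsWeightedHomogeneous w p) (n : ℕ) : (f ^ n).IsWeightedHomogeneous w (n * p) := by
  induction n with
  | zero =>
    rw [pow_zero, zero_mul]
    exact MvPowerSeries.isWeightedHomogeneous_one' w
  | succ n ih =>
    rw [pow_succ, Nat.succ_mul]
    exact ih.mul hf

/-- Finite products of weighted-homogeneous series are weighted-homogeneous. [folklore] -/
theorem MvPowerSeries.IsWeightedHomogeneous.prod' {w : σ → ℕ} {ι : Type*} (s : Finset ι)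
    {f : ι → MvPowerSeries σ k} {p : ι → ℕ} (hf : ∀ i ∈ s, (f i).IsWeightedHomogeneous w (p i)) :
    (∏ i ∈ s, f i).IsWeightedHomogeneous w (∑ i ∈ s, p i) := by
  classical
  induction s using Finset.induction_on with
  | empty =>
    rw [Finset.prod_empty, Finset.sum_empty]
    exact MvPowerSeries.isWeightedHomogeneous_one' w
  | insert a s ha ih =>
    rw [Finset.prod_insert ha, Finset.sum_insert ha]
    exact MvPowerSeries.IsWeightedHomogeneous.mul (hf a (Finset.mem_insert_self a s))
      (ih fun i hi => hf i (Finset.mem_insert_of_mem hi))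

/-- The weighted order of a non-zero weighted-homogeneous series is its weight. [folklore] -/
theorem MvPowerSeries.IsWeightedHomogeneous.weightedOrder_eq {w : σ → ℕ} {f : MvPowerSeries σ k}
    {p : ℕ} (hf : f.IsWeightedHomogeneous w p) (hf0 : f ≠ 0) : f.weightedOrder w = p := by
  apply le_antisymm
  · obtain ⟨d, hd⟩ := (MvPowerSeries.ne_zero_iff_exists_coeff_ne_zero f).mp hf0
    have h := MvPowerSeries.weightedOrder_le w hd
    rwa [hf hd] at h
  · exact MvPowerSeries.nat_le_weightedOrder w fun d hd => hf.coeff_eq_zero (ne_of_lt hd)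

/-- **A weighted-homogeneous component of a power series is a polynomial** (all weights being
positive, only finitely many monomials have a given weight): the truncation below the constant
multidegree `p` recovers it. [folklore] -/
theorem MvPowerSeries.exists_coe_eq_weightedHomogeneousComponent [Finite σ] (w : σ → ℕ)
    (hw : ∀ i, w i ≠ 0) (p : ℕ) (f : MvPowerSeries σ k) :
    ∃ P : MvPolynomial σ k, (P : MvPowerSeries σ k) = f.weightedHomogeneousComponent w p := by
  classical
  let n : σ →₀ ℕ := Finsupp.equivFunOnFinite.symm fun _ => p
  have hn : ∀ i, n i = p := fun i => rfl
  refine ⟨MvPowerSeries.trunc' k n (f.weightedHomogeneousComponent w p), ?_⟩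
  ext d
  rw [MvPolynomial.coeff_coe, MvPowerSeries.coeff_trunc', MvPowerSeries.coeff_weightedHomogeneousComponent]
  split_ifs with h1 h2 h2
  · rfl
  · rfl
  · exfalso
    apply h1
    intro i
    rw [hn]
    -- `d i ≤ d i * w i ≤ weight w d = p`
    have h3 : d i * w i ≤ Finsupp.weight w d := by
      rw [Finsupp.weight_apply]
      by_cases hi : i ∈ d.support
      · exact Finset.single_le_sum (f := fun j => d j * w j) (fun j _ => Nat.zero_le _) hi
      · rw [Finsupp.notMem_support_iff.mp hi, zero_mul]
        exact Nat.zero_le _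
    have h4 : d i ≤ d i * w i := Nat.le_mul_of_pos_right _ (Nat.pos_of_ne_zero (hw i))
    omega
  · rfl

/-- **Irreducibility passes from `k[X]` to `k⟦X⟧` for weighted-homogeneous polynomials.** Let all
weights be positive and let `P ∈ k[X₁, …, X_n]` be weighted-homogeneous and irreducible in the
polynomial ring. Then `P` is irreducible in `k⟦X₁, …, X_n⟧`: from `P = GH` in `k⟦X⟧` the initial
forms give `P = in(G) · in(H)` in `k[X]` (`weightedHomogeneousComponent_mul_of_le_weightedOrder`,
`weightedOrder_mul`), with `in(G)`, `in(H)` non-units when `G`, `H` are. [folklore] -/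
theorem MvPowerSeries.irreducible_coe_of_isWeightedHomogeneous [Finite σ] (w : σ → ℕ)
    (hw : ∀ i, w i ≠ 0) {P : MvPolynomial σ k} (hP : Irreducible P) {p₀ : ℕ}
    (hhom : (P : MvPowerSeries σ k).IsWeightedHomogeneous w p₀) :
    Irreducible (P : MvPowerSeries σ k) := by
  classical
  set F : MvPowerSeries σ k := (P : MvPowerSeries σ k) with hFdef
  have hF0 : F ≠ 0 := by
    intro h
    apply hP.ne_zero
    apply MvPolynomial.coe_injective
    rw [MvPolynomial.coe_zero]
    exact h
  -- the constant coefficient of `P` vanishes (else `P` is a non-zero constant, a unit)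
  have hc0 : MvPolynomial.coeff 0 P = 0 := by
    by_contra hne
    have hp₀ : p₀ = 0 := by
      have h := @hhom 0 (by rwa [MvPolynomial.coeff_coe])
      rw [map_zero] at h
      exact h.symm
    have hPC : P = MvPolynomial.C (MvPolynomial.coeff 0 P) := by
      ext d
      rw [MvPolynomial.coeff_C]
      split_ifs with hd
      · rw [← hd]
      · have h1 : Finsupp.weight w d ≠ p₀ := by
          rw [hp₀]
          intro hzero
          apply hd
          symm
          ext i
          have h3 : d i * w i ≤ Finsupp.weight w d := by
            rw [Finsupp.weight_apply]
            by_cases hi : i ∈ d.support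
            · exact Finset.single_le_sum (f := fun j => d j * w j) (fun j _ => Nat.zero_le _) hi
            · rw [Finsupp.notMem_support_iff.mp hi, zero_mul]
              exact Nat.zero_le _
          rw [hzero] at h3
          have h4 : d i * w i = 0 := Nat.le_zero.mp h3
          rcases Nat.mul_eq_zero.mp h4 with h5 | h5
          · simpa using h5
          · exact absurd h5 (hw i)
        have h2 := hhom.coeff_eq_zero h1
        rw [MvPolynomial.coeff_coe] at h2
        exact h2
    apply hP.not_isUnit
    rw [hPC]
    exact (isUnit_iff_ne_zero.mpr hne).map MvPolynomial.C
  have hFu : ¬ IsUnit F := by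
    rw [MvPowerSeries.isUnit_iff_constantCoeff, ← MvPowerSeries.coeff_zero_eq_constantCoeff_apply,
      hFdef, MvPolynomial.coeff_coe, hc0]
    exact not_isUnit_zero
  refine ⟨hFu, fun G H hGH => ?_⟩
  by_contra hcon
  rw [not_or] at hcon
  obtain ⟨hGu, hHu⟩ := hcon
  have hccG : MvPowerSeries.constantCoeff G = 0 := by
    rw [MvPowerSeries.isUnit_iff_constantCoeff, isUnit_iff_ne_zero, not_not] at hGu
    exact hGu
  have hccH : MvPowerSeries.constantCoeff H = 0 := by
    rw [MvPowerSeries.isUnit_iff_constantCoeff, isUnit_iff_ne_zero, not_not] at hHu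
    exact hHu
  have hG0 : G ≠ 0 := by
    rintro rfl
    rw [zero_mul] at hGH
    exact hF0 hGH
  have hH0 : H ≠ 0 := by
    rintro rfl
    rw [mul_zero] at hGH
    exact hF0 hGH
  -- the weighted orders `p`, `q` with `p + q = p₀`
  set p : ℕ := (G.weightedOrder w).toNat with hpdef
  set q : ℕ := (H.weightedOrder w).toNat with hqdef
  have hp : (p : ℕ∞) = G.weightedOrder w := (MvPowerSeries.ne_zero_iff_weightedOrder_finite w).mp hG0
  have hq : (q : ℕ∞) = H.weightedOrder w := (MvPowerSeries.ne_zero_iff_weightedOrder_finite w).mp hH0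
  have hFord : F.weightedOrder w = p₀ := MvPowerSeries.IsWeightedHomogeneous.weightedOrder_eq hhom hF0
  have hpq : p + q = p₀ := by
    have h1 : F.weightedOrder w = G.weightedOrder w + H.weightedOrder w := by
      rw [hGH]
      exact MvPowerSeries.weightedOrder_mul w G H
    rw [hFord, ← hp, ← hq] at h1
    exact_mod_cast h1.symm
  -- the initial forms multiply to `F`
  set inG := G.weightedHomogeneousComponent w p with hinG
  set inH := H.weightedHomogeneousComponent w q with hinH
  have hkey : F = inG * inH := by
    have h1 := MvPowerSeries.weightedHomogeneousComponent_mul_of_le_weightedOrder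
      (w := w) (f := G) (g := H) (p := p) (q := q) hp.le hq.le
    rw [← hGH, hpq] at h1
    rw [← h1]
    exact (MvPowerSeries.isWeightedHomogeneous_iff_eq_weightedHomogeneousComponent).mp hhom
  -- they are polynomials
  obtain ⟨PG, hPG⟩ := MvPowerSeries.exists_coe_eq_weightedHomogeneousComponent w hw p G
  obtain ⟨PH, hPH⟩ := MvPowerSeries.exists_coe_eq_weightedHomogeneousComponent w hw q H
  have hPfac : P = PG * PH := by
    apply MvPolynomial.coe_injective
    rw [MvPolynomial.coe_mul, hPG, hPH, ← hinG, ← hinH, ← hkey]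
  -- and non-units: their constant coefficients vanish
  have hunit : ∀ {Q : MvPolynomial σ k} {G' : MvPowerSeries σ k} {r : ℕ},
      (Q : MvPowerSeries σ k) = G'.weightedHomogeneousComponent w r →
      MvPowerSeries.constantCoeff G' = 0 → ¬ IsUnit Q := by
    intro Q G' r hQ hG' hu
    have h1 : MvPolynomial.coeff 0 Q = 0 := by
      rw [← MvPolynomial.coeff_coe, hQ, MvPowerSeries.coeff_weightedHomogeneousComponent]
      split_ifs
      · rw [MvPowerSeries.coeff_zero_eq_constantCoeff_apply, hG']
      · rfl
    have h2 : IsUnit (MvPolynomial.constantCoeff Q) := hu.map MvPolynomial.constantCoeff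
    rw [MvPolynomial.constantCoeff_eq, h1] at h2
    exact not_isUnit_zero h2
  rcases hP.isUnit_or_isUnit hPfac with h | h
  · exact hunit hPG hccG h
  · exact hunit hPH hccH h

end InitialForms

/-! ## `X_u X_v - M` is irreducible in the polynomial ring -/

section Polynomial

variable {σ : Type*} [DecidableEq σ] (k : Type*) [Field k]

/-- Reading `k[Xᵢ : i ∈ σ]` as polynomials in the distinguished variable `X_v` over
`k[X_c : c ≠ v]` (Mathlib's `optionEquivLeft` after renaming `σ ≃ Option {c // c ≠ v}`): the
distinguished variable becomes the polynomial variable. [folklore] -/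
theorem MvPolynomial.optionEquivLeft_rename_X_self (v : σ) :
    MvPolynomial.optionEquivLeft k {c // c ≠ v}
        (MvPolynomial.rename (Equiv.optionSubtypeNe v).symm (MvPolynomial.X v)) = Polynomial.X := by
  rw [MvPolynomial.rename_X, Equiv.optionSubtypeNe_symm_self, ← MvPolynomial.optionEquivLeft_symm_X,
    AlgEquiv.apply_symm_apply]

/-- The other variables become constants. [folklore] -/
theorem MvPolynomial.optionEquivLeft_rename_X_of_ne (v : σ) {c : σ} (hc : c ≠ v) :
    MvPolynomial.optionEquivLeft k {c // c ≠ v}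
        (MvPolynomial.rename (Equiv.optionSubtypeNe v).symm (MvPolynomial.X c)) =
      Polynomial.C (MvPolynomial.X ⟨c, hc⟩) := by
  rw [MvPolynomial.rename_X, Equiv.optionSubtypeNe_symm_of_ne hc,
    ← MvPolynomial.optionEquivLeft_symm_C_X, AlgEquiv.apply_symm_apply]

/-- A polynomial in the other variables becomes a constant. [folklore] -/
theorem MvPolynomial.optionEquivLeft_rename_rename_val (v : σ) (M₀ : MvPolynomial {c // c ≠ v} k) :
    MvPolynomial.optionEquivLeft k {c // c ≠ v}
        (MvPolynomial.rename (Equiv.optionSubtypeNe v).symm (MvPolynomial.rename Subtype.val M₀)) =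
      Polynomial.C M₀ := by
  rw [MvPolynomial.rename_rename]
  have hcomp : ((Equiv.optionSubtypeNe v).symm ∘ Subtype.val : {c // c ≠ v} → Option {c // c ≠ v}) =
      some := by
    ext ⟨c, hc⟩ : 1
    simp [Equiv.optionSubtypeNe_symm_of_ne hc]
  rw [hcomp]
  -- both sides are `k`-algebra maps agreeing on the variables
  have key : ((MvPolynomial.optionEquivLeft k {c // c ≠ v}).toAlgHom.comp
      (MvPolynomial.rename some)) =
      (Polynomial.CAlgHom : MvPolynomial {c // c ≠ v} k →ₐ[k] Polynomial (MvPolynomial {c // c ≠ v} k)) := by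
    apply MvPolynomial.algHom_ext
    intro i
    rw [AlgHom.comp_apply, MvPolynomial.rename_X]
    change MvPolynomial.optionEquivLeft k {c // c ≠ v} (MvPolynomial.X (some i)) = Polynomial.C (MvPolynomial.X i)
    rw [← MvPolynomial.optionEquivLeft_symm_C_X, AlgEquiv.apply_symm_apply]
  exact congrArg (fun φ => φ M₀) key

variable {k}

/-- **A polynomial `a X - b` of degree one over a domain is irreducible** as soon as every
constant common divisor of `a` and `b` is a unit. [folklore] -/
theorem Polynomial.irreducible_C_mul_X_sub_C {S : Type*} [CommRing S] [IsDomain S] {a b : S}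
    (ha : a ≠ 0) (hab : ∀ c : S, c ∣ a → c ∣ b → IsUnit c) :
    Irreducible (Polynomial.C a * Polynomial.X - Polynomial.C b) := by
  set F' : Polynomial S := Polynomial.C a * Polynomial.X - Polynomial.C b with hF'
  have hdeg : F'.natDegree = 1 := by
    rw [hF', Polynomial.natDegree_sub_C, Polynomial.natDegree_C_mul_X a ha]
  have hF'0 : F' ≠ 0 := by
    intro h
    rw [h, Polynomial.natDegree_zero] at hdeg
    exact zero_ne_one hdeg
  have hcoeff1 : F'.coeff 1 = a := by
    rw [hF', Polynomial.coeff_sub, Polynomial.coeff_C_mul_X, Polynomial.coeff_C, if_pos rfl,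
      if_neg one_ne_zero, sub_zero]
  have hcoeff0 : F'.coeff 0 = -b := by
    rw [hF', Polynomial.coeff_sub, Polynomial.coeff_C_mul_X, Polynomial.coeff_C_zero,
      if_neg (zero_ne_one : (0 : ℕ) ≠ 1), zero_sub]
  -- a constant divisor of `F'` is a unit
  have hconst : ∀ c₀ : S, Polynomial.C c₀ ∣ F' → IsUnit c₀ := by
    intro c₀ hc₀
    rw [Polynomial.C_dvd_iff_dvd_coeff] at hc₀
    have h1 : c₀ ∣ a := hcoeff1 ▸ hc₀ 1
    have h0 : c₀ ∣ b := by
      have := hc₀ 0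
      rw [hcoeff0, dvd_neg] at this
      exact this
    exact hab c₀ h1 h0
  refine ⟨?_, fun P Q hPQ => ?_⟩
  · intro hu
    have := Polynomial.natDegree_eq_zero_of_isUnit hu
    rw [hdeg] at this
    exact one_ne_zero this
  · have hP0 : P ≠ 0 := by
      rintro rfl
      rw [zero_mul] at hPQ
      exact hF'0 hPQ
    have hQ0 : Q ≠ 0 := by
      rintro rfl
      rw [mul_zero] at hPQ
      exact hF'0 hPQ
    have hsum : P.natDegree + Q.natDegree = 1 := by
      rw [← Polynomial.natDegree_mul hP0 hQ0, ← hPQ, hdeg]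
    rcases Nat.eq_zero_or_pos P.natDegree with hP1 | hP1
    · left
      have hPC : P = Polynomial.C (P.coeff 0) := Polynomial.eq_C_of_natDegree_eq_zero hP1
      rw [hPC]
      refine (hconst _ ?_).map Polynomial.C
      rw [← hPC]
      exact ⟨Q, hPQ⟩
    · right
      have hQ1 : Q.natDegree = 0 := by omega
      have hQC : Q = Polynomial.C (Q.coeff 0) := Polynomial.eq_C_of_natDegree_eq_zero hQ1
      rw [hQC]
      refine (hconst _ ?_).map Polynomial.C
      rw [← hQC]
      exact ⟨P, by rw [hPQ, mul_comm]⟩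

/-- **`X_u X_v - M` is irreducible in `k[X]`** when `M` does not involve `X_v` and is not
divisible by `X_u` (`u ≠ v`): read in `(k[X_c : c ≠ v])[X_v]` it is `X_u · X_v - M`, of degree
one, so a factorisation has a constant factor `c₀ ∈ k[X_c : c ≠ v]` dividing `X_u` and `M`;
`X_u` being prime, `c₀` is a unit or an associate of `X_u`, and the latter would divide `M`.
[folklore] -/
theorem MvPolynomial.irreducible_X_mul_X_sub_rename (u v : σ) (huv : u ≠ v)
    (M₀ : MvPolynomial {c // c ≠ v} k) (hM₀ : ¬ (MvPolynomial.X ⟨u, huv⟩ ∣ M₀)) :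
    Irreducible (MvPolynomial.X u * MvPolynomial.X v - MvPolynomial.rename Subtype.val M₀ :
      MvPolynomial σ k) := by
  let Φ : MvPolynomial σ k ≃ₐ[k] Polynomial (MvPolynomial {c // c ≠ v} k) :=
    (MvPolynomial.renameEquiv k (Equiv.optionSubtypeNe v).symm).trans
      (MvPolynomial.optionEquivLeft k {c // c ≠ v})
  have hΦ : ∀ P, Φ P = MvPolynomial.optionEquivLeft k {c // c ≠ v}
      (MvPolynomial.rename (Equiv.optionSubtypeNe v).symm P) := fun P => rfl
  have hΦF : Φ (MvPolynomial.X u * MvPolynomial.X v - MvPolynomial.rename Subtype.val M₀) =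
      Polynomial.C (MvPolynomial.X ⟨u, huv⟩) * Polynomial.X - Polynomial.C M₀ := by
    rw [map_sub, map_mul, hΦ, hΦ, hΦ, MvPolynomial.optionEquivLeft_rename_X_of_ne k v huv,
      MvPolynomial.optionEquivLeft_rename_X_self, MvPolynomial.optionEquivLeft_rename_rename_val]
  refine (MulEquiv.irreducible_iff Φ).mp ?_
  rw [hΦF]
  refine Polynomial.irreducible_C_mul_X_sub_C (MvPolynomial.X_ne_zero _) fun c₀ h1 h0 => ?_
  obtain ⟨e, he⟩ := h1
  have hXp : Prime (MvPolynomial.X (⟨u, huv⟩ : {c // c ≠ v}) : MvPolynomial {c // c ≠ v} k) :=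
    MvPolynomial.X_prime
  rcases hXp.irreducible.isUnit_or_isUnit he with hu' | hu'
  · exact hu'
  · exfalso
    apply hM₀
    have : MvPolynomial.X ⟨u, huv⟩ ∣ c₀ :=
      ⟨↑hu'.unit⁻¹, by rw [he, mul_assoc, IsUnit.mul_val_inv, mul_one]⟩
    exact dvd_trans this h0

end Polynomial

/-! ## The relation `uv - ∏ Tᵢ^{νᵢ}` is prime -/

namespace DeJong1996

variable (k : Type u) [Field k] (m : ℕ)

/-- Renaming the monomial `∏ Tᵢ^{νᵢ}` — written in the variables other than `v` — back into
all variables gives `∏ Tᵢ^{νᵢ}`. [folklore] -/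
theorem rename_val_prod_X_pow (ν : Fin m → ℕ) :
    MvPolynomial.rename Subtype.val
        (∏ i, MvPolynomial.X ⟨Sum.inr i, Sum.inr_ne_inl⟩ ^ ν i :
          MvPolynomial {c : Fin 2 ⊕ Fin m // c ≠ Sum.inl 1} k) =
      ∏ i, (MvPolynomial.X (Sum.inr i) : MvPolynomial (Fin 2 ⊕ Fin m) k) ^ ν i := by
  rw [map_prod]
  refine Finset.prod_congr rfl fun i _ => ?_
  rw [map_pow, MvPolynomial.rename_X]

/-- `u` does not divide the monomial `∏ Tᵢ^{νᵢ}` (evaluate at `u = 0`, `Tᵢ = 1`). [folklore] -/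
theorem not_X_dvd_prod_X_pow (ν : Fin m → ℕ) :
    ¬ ((MvPolynomial.X ⟨Sum.inl 0, by simp⟩ : MvPolynomial {c : Fin 2 ⊕ Fin m // c ≠ Sum.inl 1} k) ∣
        ∏ i, MvPolynomial.X ⟨Sum.inr i, Sum.inr_ne_inl⟩ ^ ν i) := by
  intro h
  let s : {c : Fin 2 ⊕ Fin m // c ≠ Sum.inl 1} → k := fun c => if c.1 = Sum.inl 0 then 0 else 1
  have h1 := map_dvd (MvPolynomial.eval s) h
  rw [MvPolynomial.eval_X, map_prod] at h1
  simp only [map_pow, MvPolynomial.eval_X, s, if_pos rfl] at h1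
  have h2 : (∏ i : Fin m, (if (Sum.inr i : Fin 2 ⊕ Fin m) = Sum.inl 0 then (0 : k) else 1) ^ ν i) = 1 := by
    refine Finset.prod_eq_one fun i _ => ?_
    rw [if_neg Sum.inr_ne_inl, one_pow]
  rw [h2, zero_dvd_iff] at h1
  exact one_ne_zero h1

/-- The relation of 3.3 as the image of a polynomial. [folklore] -/
theorem coe_X_mul_X_sub_rename_prod_X_pow (ν : Fin m → ℕ) :
    ((MvPolynomial.X (Sum.inl 0) * MvPolynomial.X (Sum.inl 1) -
        MvPolynomial.rename Subtype.val
          (∏ i, MvPolynomial.X ⟨Sum.inr i, Sum.inr_ne_inl⟩ ^ ν i :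
            MvPolynomial {c : Fin 2 ⊕ Fin m // c ≠ Sum.inl 1} k) :
        MvPolynomial (Fin 2 ⊕ Fin m) k) : MvPowerSeries (Fin 2 ⊕ Fin m) k) =
      formalNodeRelation k m ν := by
  rw [rename_val_prod_X_pow, formalNodeRelation, ← MvPolynomial.coeToMvPowerSeries.ringHom_apply,
    map_sub, map_mul, map_prod]
  simp only [map_pow, MvPolynomial.coeToMvPowerSeries.ringHom_apply, MvPolynomial.coe_X]

/-- The relation `uv - ∏ Tᵢ^{νᵢ}` is weighted-homogeneous of weight `2N` for the weights
`w(u) = w(v) = N = Σ νᵢ`, `w(Tᵢ) = 2`. [folklore] -/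
theorem isWeightedHomogeneous_formalNodeRelation (ν : Fin m → ℕ) :
    (formalNodeRelation k m ν).IsWeightedHomogeneous
      (Sum.elim (fun _ : Fin 2 => ∑ i, ν i) (fun _ : Fin m => 2)) (2 * ∑ i, ν i) := by
  let w : Fin 2 ⊕ Fin m → ℕ := Sum.elim (fun _ : Fin 2 => ∑ i, ν i) (fun _ : Fin m => 2)
  have e1 : w (Sum.inl 0) + w (Sum.inl 1) = 2 * ∑ i, ν i := by
    change (∑ i, ν i) + (∑ i, ν i) = _
    ring
  have h1 : (MvPowerSeries.X (Sum.inl 0) * MvPowerSeries.X (Sum.inl 1) :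
      MvPowerSeries (Fin 2 ⊕ Fin m) k).IsWeightedHomogeneous w (2 * ∑ i, ν i) := by
    rw [← e1]
    exact MvPowerSeries.IsWeightedHomogeneous.mul
      (MvPowerSeries.isWeightedHomogeneous_X' (k := k) w (Sum.inl 0))
      (MvPowerSeries.isWeightedHomogeneous_X' (k := k) w (Sum.inl 1))
  have h2' : ∀ i ∈ (Finset.univ : Finset (Fin m)),
      ((MvPowerSeries.X (Sum.inr i) : MvPowerSeries (Fin 2 ⊕ Fin m) k) ^ ν i
        ).IsWeightedHomogeneous w (ν i * 2) := fun i _ =>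
    MvPowerSeries.IsWeightedHomogeneous.pow'
      (MvPowerSeries.isWeightedHomogeneous_X' (k := k) w (Sum.inr i)) (ν i)
  have e2 : (∑ i, ν i * 2) = 2 * ∑ i, ν i := by
    rw [← Finset.sum_mul]
    ring
  have h2 : (∏ i, (MvPowerSeries.X (Sum.inr i) : MvPowerSeries (Fin 2 ⊕ Fin m) k) ^ ν i
      ).IsWeightedHomogeneous w (2 * ∑ i, ν i) := by
    rw [← e2]
    exact MvPowerSeries.IsWeightedHomogeneous.prod' Finset.univ h2'
  show (MvPowerSeries.X (Sum.inl 0) * MvPowerSeries.X (Sum.inl 1) -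
      ∏ i, (MvPowerSeries.X (Sum.inr i) : MvPowerSeries (Fin 2 ⊕ Fin m) k) ^ ν i
    ).IsWeightedHomogeneous w (2 * ∑ i, ν i)
  exact MvPowerSeries.IsWeightedHomogeneous.sub' h1 h2

/-- **The relation `uv - ∏ Tᵢ^{νᵢ}` of de Jong 1996, 3.3 is a prime element of
`k⟦u, v, T₁, …, T_m⟧`** for every exponent vector `ν ≠ 0`: it is a weighted-homogeneous polynomial
irreducible in `k[u, v, T]`, hence irreducible in the factorial ring `k⟦u, v, T⟧`.
[cite: DeJong1996, 3.3, p. 63] -/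
theorem prime_formalNodeRelation {ν : Fin m → ℕ} (hν : ∃ i, ν i ≠ 0) :
    Prime (formalNodeRelation k m ν) := by
  classical
  haveI := isRegularLocalRing_mvPowerSeries k (Fin 2 ⊕ Fin m)
  haveI : UniqueFactorizationMonoid (MvPowerSeries (Fin 2 ⊕ Fin m) k) :=
    IsRegularLocalRing.uniqueFactorizationMonoid (MvPowerSeries (Fin 2 ⊕ Fin m) k)
  refine UniqueFactorizationMonoid.irreducible_iff_prime.mp ?_
  rw [← coe_X_mul_X_sub_rename_prod_X_pow]
  have hN : (∑ i, ν i) ≠ 0 := by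
    obtain ⟨i, hi⟩ := hν
    intro h
    exact hi ((Finset.sum_eq_zero_iff.mp h) i (Finset.mem_univ i))
  refine MvPowerSeries.irreducible_coe_of_isWeightedHomogeneous
    (Sum.elim (fun _ : Fin 2 => ∑ i, ν i) (fun _ : Fin m => 2)) ?_
    (MvPolynomial.irreducible_X_mul_X_sub_rename (Sum.inl 0) (Sum.inl 1) (by simp)
      _ (not_X_dvd_prod_X_pow k m ν)) (p₀ := 2 * ∑ i, ν i) ?_
  · rintro (j | i)
    · exact hN
    · exact two_ne_zero
  · rw [coe_X_mul_X_sub_rename_prod_X_pow]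
    exact isWeightedHomogeneous_formalNodeRelation k m ν

/-- **The formal node ring `k⟦u, v, T₁, …, T_m⟧/(uv - ∏ Tᵢ^{νᵢ})` is an integral domain** for
`ν ≠ 0`. [cite: DeJong1996, 3.3, p. 63] -/
theorem FormalNodeRing.isDomain {ν : Fin m → ℕ} (hν : ∃ i, ν i ≠ 0) :
    IsDomain (FormalNodeRing k m ν) := by
  haveI := (Ideal.span_singleton_prime (prime_formalNodeRelation k m hν).ne_zero).mpr
    (prime_formalNodeRelation k m hν)
  exact Ideal.Quotient.isDomain _

end DeJong1996

end Literature.AlgebraicGeometry.Resolution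

end
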